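import Summits.ResolutionOfSingularities.ResolutionOfSingularities.Theorems.PurelyInseparableDim4LoopCRegion
import Summits.ResolutionOfSingularities.ResolutionOfSingularities.Theorems.PurelyInseparableDim4ComponentThreadsMode1h
import HarnessLib

/-!
# LOOP-C read for the MODE OF RECORD: an infinite MODE-1h branch IN COORDINATE SCOPE at `(p,q) = (3,3)`
# (cell `res-dim4-pi`, seat res-dim4-p-8 g2; corollary of `…LoopCRegion` p662411)

[OURS · counted 0 · a statement about OUR coordinate-centre frame (WORD #10's MODE 1h = `PIDim4.Step1h`:
blow up a Hironaka-permissible coordinate centre of LEAST `|S|`, every tie allowed, then pass to any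
equimultiple point of a chart — the GLOBAL game `Edge`); nothing here is about the local game, about
`TerminatesInScope 3 3` in its ∃-rule form, or about resolution of singularities in dimension `≥ 4` /
characteristic `p`.]

The board sentence of WORD #45 (3) «F4-C-glob(3,3) restricted to MODE 1h's class is FALSE as typed — LOOP-C»
in the kernel.  Dictionary: a MODE-1h centre (`IsMode1hCentre`: permissible, least cardinality among the
permissible coordinate centres) of a non-zero `F` is a COMPONENT (p-6 g2's
`ComponentThreads.isComponent_of_isMode1hCentre`) and of least cardinality among components
(`maxDim_of_isMode1hCentre` below), i.e. exactly a maximal-dimensional component of `…LoopCRegion`; and every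
`q`-fold state admits a MODE-1h centre (`exists_isMode1hCentre`, least `|S|` over the finitely many permissible
`S`).  Hence the LOOP-C region, closed in `Edge` against every maximal-dimensional component
(`LoopC.loopC_region`), carries an infinite `Step1h 3` branch all of whose states are in coordinate scope:
**`exists_inScope_step1h_chain`**.  (`¬ Terminates1h 3 3` itself is already a tree fact for every prime via
the coordinate cage, `CoordinateCage` / `UniformTrapFrames`; the content here is IN SCOPE + the hop mechanism.)
bears_on: LADDER-RESOLUTION:D157-DOOR2 (res-dim4-pi · F4-C-glob(3,3) · MODE 1h · C-LOOP-C ‖ K).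
Supports stmt-ResolutionOfSingularities-16155 (helper).
-/

set_option linter.dupNamespace false -- mandated namespace of this single-conjunct summit

noncomputable section

open MvPolynomial Finset

namespace Summit.ResolutionOfSingularities.ResolutionOfSingularities.Theorems.PIDim4

namespace LoopC

open StepKit ComponentThreads
open Literature.AlgebraicGeometry.Resolution
open Literature.AlgebraicGeometry.Resolution.CentreBlowup

variable {K : Type} [Field K]

/-! ## §1 MODE-1h centres are maximal-dimensional components, and exist at every `q`-fold state -/

/-- A component has a non-zero polynomial (`ord_{C_{S∖k}} 0 = ⊤`). [folklore] -/
theorem ne_zero_of_isComponent {q : ℕ} {S : Finset (Fin 4)} {F : MvPolynomial (Fin 4) K}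
    (hS : IsComponent q S F) : F ≠ 0 := by
  obtain ⟨k, hk⟩ := hS.1.1
  intro hF
  apply hS.2 k hk
  rw [hF, ordAlong_zero]
  exact le_top

/-- **A MODE-1h centre is a maximal-dimensional component** (`1 ≤ q`, `F ≠ 0`). [folklore] -/
theorem maxDim_of_isMode1hCentre {q : ℕ} (hq : 1 ≤ q) {S : Finset (Fin 4)} {F : MvPolynomial (Fin 4) K}
    (hF : F ≠ 0) (h : IsMode1hCentre q S F) :
    IsComponent q S F ∧ ∀ S', IsComponent q S' F → S.card ≤ S'.card :=
  ⟨isComponent_of_isMode1hCentre hq hF h, fun S' hS' => h.2 S' hS'.1⟩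

/-- **Every `q`-fold state has a MODE-1h centre**: a permissible coordinate centre of least cardinality
(the point `S = univ` is permissible, and there are finitely many `S`). [folklore] -/
theorem exists_isMode1hCentre {q : ℕ} {F : MvPolynomial (Fin 4) K}
    (hord : (q : ℕ∞) ≤ ordAlong Finset.univ F) : ∃ S, IsMode1hCentre q S F := by
  classical
  set P : Finset (Finset (Fin 4)) := Finset.univ.filter fun S => IsPermissibleCentre q S F with hP
  have huniv : (Finset.univ : Finset (Fin 4)) ∈ P := by
    simp only [hP, Finset.mem_filter, Finset.mem_univ, true_and]
    exact ⟨Finset.univ_nonempty, hord⟩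
  obtain ⟨S, hSP, hmin⟩ := Finset.exists_min_image P Finset.card ⟨Finset.univ, huniv⟩
  simp only [hP, Finset.mem_filter, Finset.mem_univ, true_and] at hSP hmin
  exact ⟨S, hSP, fun S' hS' => hmin S' hS'⟩

/-! ## §2 The in-scope MODE-1h branch -/

/-- From every LOOP-C region state there is a MODE-1h step (`Step1h 3`) into the region. [OURS · ‖ K] -/
theorem exists_step1h_in_loopC (s : State (ZMod 3)) (hs : s ∈ trapSet loopC) :
    ∃ s' ∈ trapSet loopC, Step1h 3 s s' := by
  obtain ⟨hord, ⟨S₀, hS₀, -⟩, hall⟩ := loopC_region s hs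
  obtain ⟨S, hS⟩ := exists_isMode1hCentre hord
  have hF : s.F ≠ 0 := ne_zero_of_isComponent hS₀
  obtain ⟨hcomp, hmax⟩ := maxDim_of_isMode1hCentre (by norm_num) hF hS
  obtain ⟨s', hs', hedge⟩ := hall S hcomp hmax
  exact ⟨s', hs', S, hS, hedge⟩

/-- **An infinite MODE-1h branch IN COORDINATE SCOPE at `(3,3)` over `𝔽₃`** (inside the LOOP-C region; the
centres of least `|S|` there are the hopping planes of idea-2's specimen). [OURS · ‖ K] -/
theorem exists_inScope_step1h_chain :
    ∃ c : ℕ → State (ZMod 3), (∀ k, c k ∈ trapSet loopC) ∧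
      ∀ k, InCoordinateScope 3 (c k).F ∧ Step1h 3 (c k) (c (k + 1)) := by
  have key : ∀ s : trapSet loopC, ∃ s' : trapSet loopC,
      Step1h 3 (s : State (ZMod 3)) (s' : State (ZMod 3)) := by
    rintro ⟨s, hs⟩
    obtain ⟨s', hs', h⟩ := exists_step1h_in_loopC s hs
    exact ⟨⟨s', hs'⟩, h⟩
  choose f hf using key
  refine ⟨fun k => ((f^[k] ⟨t0.toState, t0_mem_loopC⟩ : trapSet loopC) : State (ZMod 3)),
    fun k => (f^[k] ⟨t0.toState, t0_mem_loopC⟩).2, fun k => ⟨loopC_inScope _ (f^[k] _).2, ?_⟩⟩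
  show Step1h 3 ((f^[k] _ : trapSet loopC) : State (ZMod 3)) ((f^[k + 1] _ : trapSet loopC) : State (ZMod 3))
  rw [Function.iterate_succ_apply']
  exact hf _

/-- The same branch read as MODE-2 steps (`Step2 3`: any Hironaka-permissible coordinate centre) — every
MODE-1h step is a MODE-2 step. [OURS · ‖ K] -/
theorem exists_inScope_step2_chain :
    ∃ c : ℕ → State (ZMod 3), (∀ k, c k ∈ trapSet loopC) ∧
      ∀ k, InCoordinateScope 3 (c k).F ∧ Step2 3 (c k) (c (k + 1)) := by
  obtain ⟨c, hmem, hc⟩ := exists_inScope_step1h_chain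
  refine ⟨c, hmem, fun k => ⟨(hc k).1, ?_⟩⟩
  obtain ⟨S, hS, hedge⟩ := (hc k).2
  exact ⟨S, hS.1, hedge⟩

end LoopC

end Summit.ResolutionOfSingularities.ResolutionOfSingularities.Theorems.PIDim4

end
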